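import Summits.QuantumFields.BalabanUV.T4Continuum.Support.VariationalVectorGaugeMove
import Summits.QuantumFields.BalabanUV.T4Continuum.Support.VariationalColourDirichletForm

/-!
# T⁴ programme, spine node NE2 (U1a), lane P2 — BAŁABAN's PROJECTED GAUGE FUNCTIONAL IS A SQUARED DISTANCE TO THE `K`-HARMONIC 0-FORMS,
# THE `K`-HARMONIC 0-FORMS ARE THE SCALAR SECTOR's FIBRE-MINIMISERS, and (ONE-min) WITH BACKGROUND ⇐ V-ONE's CURL HALF AT `G := 0` ∧ «V-ONE-G»
# (item «V-ONE-G WITH BACKGROUND», file 1; model level; cell `pub-balaban`)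

NE2 formalisation swarm `b2b-balaban-t4-ne2-formalise-*`, leaf prover 01 GEN 8 (`prover-b2b-balaban-t4-ne2-formalise-leaf-01-g8-0`); journal INTENT
CLAIMS.log 2026-08-20 l.18200, shape correction to leaf-10-g3's (M4) l.18192.  On top of leaf-09-g7's `VariationalVectorGaugeSlice` (p221888: `sliceSub`,
`projG`, `lapOp`, `divV`) and leaf-02-g5's `VariationalColourDirichletForm` (p221897: `dformv`, `sum_dirUv_add_smul`, `dformv_eq_zero_of_isMin`) BY NAME;
nothing of theirs restated.

WHY.  The vector END's socket (ONE-min) (leaf-01-g7 `VariationalAssemblySliceMin`, leaf-10-g3 `VariationalVectorEndMonotone.upper_bracket_of_oneMin`)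
asks, at a coarse minimiser `W₀`, for a fine field of the composite fibre whose FULL fine form `SfV R′ G′` (curl + Bałaban's gauge functional) is below
`(√(ScV R G W₀ + ε₁ρ W₀) + δ′√(qWV W₀))²`.  V-ONE-1F (`VariationalVectorOneStepPhys.SfV_interpV_le`, leaf-01-g6) bounds the CURL half of the
interpolant `interpV W₀`; at `U = 1` the `G′`-half was disposed of by a zero-cost slice move (`hONEm_tower`, p225221).  With background the slice move is
NOT free (leaf-01-g7's σ⋆ mechanism, memo `t4/T4-EST-NE2-P2-VGF.md`), and the located supplier statement is «V-ONE-G»: the fine functional of the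
interpolant is bounded by the coarse functional of the datum up to a decaying regularity defect.  This file records the three pieces of STRUCTURE that
make V-ONE-G a two-level statement about the SCALAR sector:
 * §1 **`projG_le_nsqv_sub`**: `projG R K W ≤ Σ_x‖div_R W x − s x‖²` for every `s` with `toLp s ∈ S_R(K)ᗮ`, with EQUALITY at the orthogonal representative
   (`projG_eq_norm_sub_sq`) — Bałaban's projected functional is the squared `ℓ²`-DISTANCE of `div_R W` to `S_R(K)ᗮ`;
 * §2 **`toLp_mem_orthogonal_iff_dformv`**: `toLp s ∈ S_R(K)ᗮ ↔ ∀ λ ∈ K, dformv R λ s = 0` (`S_R(K) = div_R D_R(K)`, colour summation by parts) — the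
   slice complement is the space of `K`-HARMONIC 0-forms; and for `K = ker Q_T` (the road's data) **`toLp_mem_orthogonal_iff_isMin`**: these are EXACTLY the
   fibre-minimisers of the scalar (colour) covariant Dirichlet sum `u ↦ Σ_μ dirUv R u μ` under the transported block average `Q_T` — the vector functional's
   slice complement IS the scalar sector's minimiser space; hence **`projG_le_nsqv_sub_of_isMin`**: `projG R (ker Q_T) W ≤ Σ_x‖div_R W x − u x‖²` for every
   scalar fibre-minimiser `u` (any datum), and the Pythagorean identity **`sum_dirUv_eq_add_of_isMin`** on a scalar fibre;
 * §3 **`SfV_le_of_curl_oneG`** ∕ **`hONEm_of_curl_oneG`**: (ONE-min) with background ⇐ (C)₀ = a curl half read AT `G := 0` on the coarse side ∧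
   (G′) = V-ONE-G `((nL)^d)⁻¹((nL)²·G′(J W)) ≤ (n^d)⁻¹(n²·G W) + ε_G·ρ′ W` — by `(√a + c)² + b ≤ (√(a+b) + c)²`; NO slice move, no new cross term; the
   `hONEm` socket of `VariationalAssemblySliceMin.vector_pair_bracket_sqrt_min_line` with `ρ ↦ ρ + ρ′`, `ε₁ ↦ max ε₁ ε_G`; and
   **`hONEm_of_curl_oneG_repair`**: the same for a competitor map that MISSES the composite fibre by a unit datum of size `≤ β·qWV W`, re-absorbed by the
   fine V-UB leaf through **`sqrt_SfV_add_le`** (`δ′ ↦ δ′ + √(Λβ)`).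
NUMERICS OF THIS ITEM (memo `t4/T4-EST-NE2-P2-VONEG.md`, kit j102735 ∕ j1028xx; d = 2, U(1), flat and «sin» backgrounds): (G′) FAILS for V-ONE-1F's tilted
`interpV` (its longitudinal profile `lt` has slope `≈ −3∕L`, so its fine divergence is O(1)-off: `G′(interpV W₀) ≈ 2‖X_k‖·‖φ‖²` NON-decaying) and HOLDS for
the COMPONENTWISE CENTRED interpolant (`VariationalColourInterpolant.Phiv` per component: `G′ − G ≈ 25, 10.8, 2.6, 0.62` at `n = 2, 4, 8, 16`, rate `L^{−2k}`),
whose one-step constraint fails at first order (the spill of N-ne2leaf02g4-1) but whose COMPOSITE-fibre defect is `0.25, 0.055, 0.012, 0.0026` (second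
order) — hence the repair variant.  (G′) itself is OPEN with background (DISPLAYED here); its decomposition DIV-INTERP + HARM-APPROX and the discharge of
HARM-APPROX from the scalar road's one-step brackets are the next files of this item.

HONEST FRAMING (T4-DAG p. 1).  Abstract Hilbert-space bookkeeping + lattice summation by parts at MODEL level (transports `R`, site operators `T`, the
submodule `K` DATA; c5 — no identification with Bałaban's `R_k(U)`); [folklore]; nothing printed is a hypothesis; no `def`, no `def … : Prop`, no `sorry`;
axioms standard.  (G′) ∕ (ONE-min) with background NOT proved here; V-END with background ∕ NE2 NOT proved; NE3 OPEN; spine PROVED 0∕9 unchanged; rung (B)+1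
on a fixed finite T⁴ — NOT infinite volume, NOT mass gap, NOT Clay.  HONEST DEPENDENCY (cell, verbatim): continuum YM on T⁴ ⇐ BetaPertH ∧ nine spine
estimates (0/9 proved); BetaPertH ⇐ (D1) ∧ (D4) ∧ CAP+tail; G-an2-4 gates asym, D1 and NE2/3/4.
-/

noncomputable section

namespace Summit.QuantumFields.BalabanUV.T4Continuum.VariationalVectorGaugeSliceDist

open Finset WithLp
open scoped InnerProductSpace
open Literature.MathematicalPhysics.QuantumFieldTheory.Balaban1983to89.B5Prop11Plancherel (Tor fine unitVec)
open Summit.QuantumFields.BalabanUV.T4Continuum.VariationalColourFederbush (cDv dirUv dirUv_nonneg Qcv)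
open Summit.QuantumFields.BalabanUV.T4Continuum.VariationalColourBochner (negLapv nsqv nsqv_nonneg ipv ipv_self)
open Summit.QuantumFields.BalabanUV.T4Continuum.VariationalColourDirichletForm
  (dformv sum_dirUv_add_smul dformv_eq_zero_of_isMin ipv_negLapv ipv_negLapv_left Qcv_add_smul)
open Summit.QuantumFields.BalabanUV.T4Continuum.VariationalVectorWeitzenbock (divV divSq)
open Summit.QuantumFields.BalabanUV.T4Continuum.VariationalVectorGaugeSlice
  (sliceSub mem_sliceSub projG projG_nonneg lapOp lapOp_apply lapOp_eq_negLapv avgOp avgOp_apply norm_toLp_sq)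
open Summit.QuantumFields.BalabanUV.T4Continuum.VariationalVectorForm (curlSq ScV SfV qWV curlSq_nonneg SfV_nonneg qWV_nonneg)
open Summit.QuantumFields.BalabanUV.T4Continuum.VectorBlockTrialForm (nsqV nsqV_nonneg)
open Summit.QuantumFields.BalabanUV.T4Continuum.VariationalVectorGaugeMove (sqrt_ScV_add_le)

variable {d : ℕ} (N : Fin d → ℕ) [∀ μ, NeZero (N μ)]
variable {E : Type*} [NormedAddCommGroup E] [InnerProductSpace ℂ E] [CompleteSpace E] [FiniteDimensional ℂ E]

/-! ## §1 `projG R K W` is the squared `ℓ²`-distance of `div_R W` to `S_R(K)ᗮ` -/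

section Dist

/-- for `s ∈ S_R(K)ᗮ` the projection onto `S_R(K)` does not see `s`: `Π_S(v − s) = Π_S v`. [folklore] -/
theorem starProjection_sub_of_mem_orthogonal (R : Tor N → Fin d → (E →L[ℂ] E)) (K : Submodule ℂ (Tor N → E))
    (v : PiLp 2 (fun _ : Tor N => E)) {s : PiLp 2 (fun _ : Tor N => E)} (hs : s ∈ (sliceSub N R K)ᗮ) :
    (sliceSub N R K).starProjection (v - s) = (sliceSub N R K).starProjection v := by
  rw [map_sub, (Submodule.starProjection_apply_eq_zero_iff (K := sliceSub N R K)).mpr hs, sub_zero]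

/-- **`projG ≤` the squared distance to ANY element of the slice complement**: `projG R K W ≤ ‖toLp(div_R W) − s‖²` for `s ∈ S_R(K)ᗮ`
(`Π_S(v − s) = Π_S v` and a projection is a contraction). [folklore] -/
theorem projG_le_norm_sub_sq (R : Tor N → Fin d → (E →L[ℂ] E)) (K : Submodule ℂ (Tor N → E)) (W : Tor N → Fin d → E)
    {s : PiLp 2 (fun _ : Tor N => E)} (hs : s ∈ (sliceSub N R K)ᗮ) :
    projG N R K W ≤ ‖toLp 2 (divV N R W) - s‖ ^ 2 := by
  unfold projG
  rw [← starProjection_sub_of_mem_orthogonal N R K (toLp 2 (divV N R W)) hs]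
  exact pow_le_pow_left₀ (norm_nonneg _) (Submodule.norm_starProjection_apply_le _ _) 2

/-- the orthogonal representative: `v − Π_{Sᗮ} v = Π_S v`, so **`projG R K W = ‖toLp(div_R W) − Π_{S_R(K)ᗮ}(toLp(div_R W))‖²`** — the bound of
`projG_le_norm_sub_sq` is ATTAINED in `S_R(K)ᗮ`: `projG` is the squared distance to the slice complement. [folklore] -/
theorem projG_eq_norm_sub_sq (R : Tor N → Fin d → (E →L[ℂ] E)) (K : Submodule ℂ (Tor N → E)) (W : Tor N → Fin d → E) :
    projG N R K W = ‖toLp 2 (divV N R W) - (sliceSub N R K)ᗮ.starProjection (toLp 2 (divV N R W))‖ ^ 2 := by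
  unfold projG
  rw [Submodule.starProjection_orthogonal_val, sub_sub_cancel]

/-- the minimising element lies in the complement (for use with `projG_le_norm_sub_sq` one level up). [folklore] -/
theorem starProjection_orthogonal_mem (R : Tor N → Fin d → (E →L[ℂ] E)) (K : Submodule ℂ (Tor N → E)) (v : PiLp 2 (fun _ : Tor N => E)) :
    (sliceSub N R K)ᗮ.starProjection v ∈ (sliceSub N R K)ᗮ :=
  Submodule.starProjection_apply_mem _ v

omit [InnerProductSpace ℂ E] [CompleteSpace E] [FiniteDimensional ℂ E] in
/-- the `ℓ²` norm of a difference read in the function world: `‖toLp a − toLp b‖² = Σ_x‖a x − b x‖²`. [folklore] -/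
theorem norm_toLp_sub_sq (a b : Tor N → E) : ‖toLp 2 a - toLp 2 b‖ ^ 2 = ∑ x, ‖a x - b x‖ ^ 2 := by
  rw [← toLp_sub, norm_toLp_sq]
  rfl

/-- **FUNCTION-WORLD FORM**: `projG R K W ≤ Σ_x‖div_R W x − s x‖²` for every 0-form `s` with `toLp s ∈ S_R(K)ᗮ`. [folklore] -/
theorem projG_le_nsqv_sub (R : Tor N → Fin d → (E →L[ℂ] E)) (K : Submodule ℂ (Tor N → E)) (W : Tor N → Fin d → E)
    {s : Tor N → E} (hs : toLp 2 s ∈ (sliceSub N R K)ᗮ) :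
    projG N R K W ≤ ∑ x, ‖divV N R W x - s x‖ ^ 2 := by
  rw [← norm_toLp_sub_sq]
  exact projG_le_norm_sub_sq N R K W hs

end Dist

/-! ## §2 The slice complement = the `K`-harmonic 0-forms = (for `K = ker Q_T`) the scalar sector's fibre-minimisers -/

section Harmonic

omit [CompleteSpace E] [FiniteDimensional ℂ E] in
/-- the `PiLp 2` inner product of two read-in functions is the lattice pairing `ipv`. [folklore] -/
theorem inner_toLp_eq_ipv (a b : Tor N → E) : ⟪toLp 2 a, toLp 2 b⟫_ℂ = ipv N a b := rfl

omit [FiniteDimensional ℂ E] in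
/-- **THE SLICE COMPLEMENT IS THE SPACE OF `K`-HARMONIC 0-FORMS, pairing form**: `toLp s ∈ S_R(K)ᗮ ↔ ∀ λ ∈ K, ipv (div_R D_R λ) s = 0`. [folklore] -/
theorem toLp_mem_orthogonal_iff_ipv (R : Tor N → Fin d → (E →L[ℂ] E)) (K : Submodule ℂ (Tor N → E)) (s : Tor N → E) :
    toLp 2 s ∈ (sliceSub N R K)ᗮ ↔ ∀ f ∈ K, ipv N (lapOp N R f) s = 0 := by
  rw [Submodule.mem_orthogonal]
  constructor
  · intro h f hf
    have := h (toLp 2 (lapOp N R f)) (Submodule.mem_map_of_mem (f := lapOp N R) hf)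
    rwa [inner_toLp_eq_ipv] at this
  · intro h u hu
    rw [mem_sliceSub, Submodule.mem_map] at hu
    obtain ⟨f, hf, hfu⟩ := hu
    have e : u = toLp 2 (lapOp N R f) := by rw [hfu, toLp_ofLp]
    rw [e, inner_toLp_eq_ipv]
    exact h f hf

omit [FiniteDimensional ℂ E] in
/-- **… Dirichlet-form form**: `toLp s ∈ S_R(K)ᗮ ↔ ∀ λ ∈ K, dformv R λ s = 0` — `ipv (D†D λ) s = Σ_μ ipv (D_μλ) (D_μ s)` by the exact colour summation
by parts (`ipv_negLapv_left`, `lapOp = negLapv` definitionally). [folklore] -/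
theorem toLp_mem_orthogonal_iff_dformv (R : Tor N → Fin d → (E →L[ℂ] E)) (K : Submodule ℂ (Tor N → E)) (s : Tor N → E) :
    toLp 2 s ∈ (sliceSub N R K)ᗮ ↔ ∀ f ∈ K, dformv N R f s = 0 := by
  rw [toLp_mem_orthogonal_iff_ipv]
  refine forall₂_congr fun f _ => ?_
  rw [lapOp_eq_negLapv, ipv_negLapv_left]

omit [FiniteDimensional ℂ E] in
/-- … and in the Euler–Lagrange form `ipv λ (D†D s) = 0` (`ipv_negLapv`): `s` is `K`-harmonic iff `D†_R D_R s ⊥ K`. [folklore] -/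
theorem toLp_mem_orthogonal_iff_ipv_negLapv (R : Tor N → Fin d → (E →L[ℂ] E)) (K : Submodule ℂ (Tor N → E)) (s : Tor N → E) :
    toLp 2 s ∈ (sliceSub N R K)ᗮ ↔ ∀ f ∈ K, ipv N f (negLapv N R s) = 0 := by
  rw [toLp_mem_orthogonal_iff_dformv]
  refine forall₂_congr fun f _ => ?_
  rw [ipv_negLapv]

variable (n : ℕ) [NeZero n] (M : Fin d → ℕ) [hM : ∀ μ, NeZero (M μ)]

omit [NeZero n] hM [CompleteSpace E] [FiniteDimensional ℂ E] in
/-- membership in the kernel of the bundled average is the vanishing of the transported block average. [folklore] -/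
theorem mem_ker_avgOp_iff (T : Tor (fine n M) → (E →L[ℂ] E)) (h : Tor (fine n M) → E) :
    h ∈ LinearMap.ker (avgOp n M T) ↔ Qcv n M T h = 0 := LinearMap.mem_ker

omit [FiniteDimensional ℂ E] in
/-- **THE SLICE COMPLEMENT OF `K = ker Q_T` IS THE SCALAR SECTOR's MINIMISER SPACE** (model level; `R`, `T` DATA): `toLp s ∈ S_R(ker Q_T)ᗮ` iff `s`
minimises the scalar covariant Dirichlet sum `u ↦ Σ_μ dirUv R u μ` on its own fibre `{u : Q_T u = Q_T s}` of the transported block average.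
(⇐: leaf-02-g5's first variation `dformv_eq_zero_of_isMin`; ⇒: `Σ dirUv (s + h) = Σ dirUv s + 2·Re dformv h s + Σ dirUv h` with the middle term zero
for `h ∈ ker Q_T`.) [folklore] -/
theorem toLp_mem_orthogonal_iff_isMin (T : Tor (fine n M) → (E →L[ℂ] E)) (R : Tor (fine n M) → Fin d → (E →L[ℂ] E)) (s : Tor (fine n M) → E) :
    toLp 2 s ∈ (sliceSub (fine n M) R (LinearMap.ker (avgOp n M T)))ᗮ ↔
      ∀ g, Qcv n M T g = Qcv n M T s → ∑ ν, dirUv (fine n M) R s ν ≤ ∑ ν, dirUv (fine n M) R g ν := by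
  rw [toLp_mem_orthogonal_iff_dformv]
  constructor
  · intro h g hg
    -- `g = s + 1•(g − s)` with `g − s ∈ ker Q_T`
    have hker : Qcv n M T (g - s) = 0 := by
      have e := Qcv_add_smul n M T s (g - s) 1
      rw [one_smul, add_sub_cancel, one_smul, hg] at e
      exact (add_eq_left.mp e.symm)
    have hz : dformv (fine n M) R (g - s) s = 0 := h (g - s) ((mem_ker_avgOp_iff n M T _).mpr hker)
    have e := sum_dirUv_add_smul (fine n M) R s (g - s) 1
    rw [Complex.ofReal_one, one_smul, add_sub_cancel, hz, Complex.zero_re, mul_zero, add_zero, one_pow, one_mul] at e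
    rw [e]
    exact le_add_of_nonneg_right (sum_nonneg fun ν _ => dirUv_nonneg _ _ _ _)
  · intro hmin f hf
    exact dformv_eq_zero_of_isMin n M T R rfl hmin ((mem_ker_avgOp_iff n M T f).mp hf)

/-- **`projG` AGAINST ANY SCALAR MINIMISER**: `projG R (ker Q_T) W ≤ Σ_x‖div_R W x − u x‖²` for every fibre-minimiser `u` of the scalar covariant Dirichlet
sum under `Q_T` (any datum `ψ`) — the form in which V-ONE-G consumes the SCALAR sector one level up. [folklore] -/
theorem projG_le_nsqv_sub_of_isMin (T : Tor (fine n M) → (E →L[ℂ] E)) (R : Tor (fine n M) → Fin d → (E →L[ℂ] E))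
    (W : Tor (fine n M) → Fin d → E) {ψ : Tor M → E} {u : Tor (fine n M) → E} (hu : Qcv n M T u = ψ)
    (hmin : ∀ g, Qcv n M T g = ψ → ∑ ν, dirUv (fine n M) R u ν ≤ ∑ ν, dirUv (fine n M) R g ν) :
    projG (fine n M) R (LinearMap.ker (avgOp n M T)) W ≤ ∑ x, ‖divV (fine n M) R W x - u x‖ ^ 2 := by
  refine projG_le_nsqv_sub (fine n M) R _ W ((toLp_mem_orthogonal_iff_isMin n M T R u).mpr fun g hg => hmin g ?_)
  rw [hg, hu]

/-- conversely the orthogonal representative `Π_{Sᗮ}(div_R W)` (where `projG` is attained, §1) IS a scalar fibre-minimiser for its own datum. [folklore] -/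
theorem isMin_starProjection_orthogonal (T : Tor (fine n M) → (E →L[ℂ] E)) (R : Tor (fine n M) → Fin d → (E →L[ℂ] E))
    (v : PiLp 2 (fun _ : Tor (fine n M) => E)) (g : Tor (fine n M) → E)
    (hg : Qcv n M T g = Qcv n M T (WithLp.ofLp ((sliceSub (fine n M) R (LinearMap.ker (avgOp n M T)))ᗮ.starProjection v))) :
    ∑ ν, dirUv (fine n M) R (WithLp.ofLp ((sliceSub (fine n M) R (LinearMap.ker (avgOp n M T)))ᗮ.starProjection v)) ν
      ≤ ∑ ν, dirUv (fine n M) R g ν := by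
  exact (toLp_mem_orthogonal_iff_isMin n M T R _).mp (starProjection_orthogonal_mem (fine n M) R (LinearMap.ker (avgOp n M T)) v) g hg

omit [CompleteSpace E] [FiniteDimensional ℂ E] in
/-- **PYTHAGORAS ON A SCALAR FIBRE**: if `u` minimises `Σ dirUv R` on `{Q_T = ψ}` and `g` lies in the same fibre, then
`Σ_μ dirUv R g μ = Σ_μ dirUv R u μ + Σ_μ dirUv R (g − u) μ` — the excess energy of a competitor IS the energy of its distance to the minimiser
(the identity behind HARM-APPROX: an energy-good interpolant of the coarse harmonic is energy-CLOSE to the fine harmonic). [folklore] -/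
theorem sum_dirUv_eq_add_of_isMin (T : Tor (fine n M) → (E →L[ℂ] E)) (R : Tor (fine n M) → Fin d → (E →L[ℂ] E))
    {ψ : Tor M → E} {u : Tor (fine n M) → E} (hu : Qcv n M T u = ψ)
    (hmin : ∀ g, Qcv n M T g = ψ → ∑ ν, dirUv (fine n M) R u ν ≤ ∑ ν, dirUv (fine n M) R g ν)
    {g : Tor (fine n M) → E} (hg : Qcv n M T g = ψ) :
    ∑ ν, dirUv (fine n M) R g ν = ∑ ν, dirUv (fine n M) R u ν + ∑ ν, dirUv (fine n M) R (g - u) ν := by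
  have hker : Qcv n M T (g - u) = 0 := by
    have e := Qcv_add_smul n M T u (g - u) 1
    rw [one_smul, add_sub_cancel, one_smul, hg, hu] at e
    exact (add_eq_left.mp e.symm)
  have hz : dformv (fine n M) R (g - u) u = 0 := dformv_eq_zero_of_isMin n M T R hu hmin hker
  have e := sum_dirUv_add_smul (fine n M) R u (g - u) 1
  rw [Complex.ofReal_one, one_smul, add_sub_cancel, hz, Complex.zero_re, mul_zero, add_zero, one_pow, one_mul] at e
  exact e

end Harmonic

/-! ## §3 (ONE-min) WITH BACKGROUND ⇐ V-ONE's curl half AT `G := 0` ∧ V-ONE-G — no slice move -/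

section OneMin

omit [∀ μ, NeZero (N μ)] in
/-- `(√a + c)² + b ≤ (√(a + b) + c)²` for `0 ≤ a, b, c` (`√a ≤ √(a+b)`). [folklore] -/
theorem sq_sqrt_add_add_le {a b c : ℝ} (ha : 0 ≤ a) (hb : 0 ≤ b) (hc : 0 ≤ c) :
    (Real.sqrt a + c) ^ 2 + b ≤ (Real.sqrt (a + b) + c) ^ 2 := by
  have h1 : Real.sqrt a ≤ Real.sqrt (a + b) := Real.sqrt_le_sqrt (by linarith)
  have h2 : Real.sqrt a ^ 2 = a := Real.sq_sqrt ha
  have h3 : Real.sqrt (a + b) ^ 2 = a + b := Real.sq_sqrt (by linarith)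
  nlinarith [Real.sqrt_nonneg a, Real.sqrt_nonneg (a + b)]

variable (n L : ℕ) [NeZero n] [NeZero L] (M : Fin d → ℕ) [hM : ∀ μ, NeZero (M μ)]

omit [InnerProductSpace ℂ E] [CompleteSpace E] [FiniteDimensional ℂ E] in
/-- the coarse form splits: `ScV R G W = ScV R 0 W + (n^d)⁻¹(n²·G W)`. [folklore] -/
theorem ScV_eq_zero_add [NormedSpace ℂ E] (R : Tor (fine n M) → Fin d → (E →L[ℂ] E)) (G : (Tor (fine n M) → Fin d → E) → ℝ)
    (W : Tor (fine n M) → Fin d → E) :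
    ScV n M R G W = ScV n M R (fun _ => 0) W + ((n : ℝ) ^ d)⁻¹ * ((n : ℝ) ^ 2 * G W) := by
  unfold ScV; ring

omit [InnerProductSpace ℂ E] [CompleteSpace E] [FiniteDimensional ℂ E] in
/-- the fine form splits: `SfV R′ G′ V = SfV R′ 0 V + ((nL)^d)⁻¹((nL)²·G′ V)`. [folklore] -/
theorem SfV_eq_zero_add [NormedSpace ℂ E] (R' : Tor (fine L (fine n M)) → Fin d → (E →L[ℂ] E))
    (G' : (Tor (fine L (fine n M)) → Fin d → E) → ℝ) (V : Tor (fine L (fine n M)) → Fin d → E) :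
    SfV n L M R' G' V = SfV n L M R' (fun _ => 0) V + (((n : ℝ) * L) ^ d)⁻¹ * (((n : ℝ) * L) ^ 2 * G' V) := by
  unfold SfV; ring

omit [InnerProductSpace ℂ E] [CompleteSpace E] [FiniteDimensional ℂ E] in
/-- **(ONE-min)'s COMPETITOR WITHOUT A SLICE MOVE**: if a fine field `V` (think `V = interpV W`, V-ONE-1F's tilted interpolant) has
(C)₀ its PURE-CURL fine form below `(√(ScV R 0 W + e₁) + δ)²` (V-ONE-1F's `SfV_interpV_le` read AT `G := 0`: the coarse `G`-budget is NOT spent) and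
(G′) its fine gauge functional below the coarse one plus a defect, `((nL)^d)⁻¹((nL)²·G′ V) ≤ (n^d)⁻¹(n²·G W) + e_G` («V-ONE-G», DISPLAYED), then its FULL
fine form is below `(√(ScV R G W + e₁ + e_G) + δ)²` — `(√a + c)² + b ≤ (√(a+b) + c)²`. [folklore] -/
theorem SfV_le_of_curl_oneG [NormedSpace ℂ E] {R : Tor (fine n M) → Fin d → (E →L[ℂ] E)} {R' : Tor (fine L (fine n M)) → Fin d → (E →L[ℂ] E)}
    {G : (Tor (fine n M) → Fin d → E) → ℝ} {G' : (Tor (fine L (fine n M)) → Fin d → E) → ℝ} (hG0 : ∀ W, 0 ≤ G W)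
    {W : Tor (fine n M) → Fin d → E} {V : Tor (fine L (fine n M)) → Fin d → E} {e₁ eG δ : ℝ} (he₁ : 0 ≤ e₁) (heG : 0 ≤ eG) (hδ : 0 ≤ δ)
    (hC : SfV n L M R' (fun _ => 0) V ≤ (Real.sqrt (ScV n M R (fun _ => 0) W + e₁) + δ) ^ 2)
    (hG : (((n : ℝ) * L) ^ d)⁻¹ * (((n : ℝ) * L) ^ 2 * G' V) ≤ ((n : ℝ) ^ d)⁻¹ * ((n : ℝ) ^ 2 * G W) + eG) :
    SfV n L M R' G' V ≤ (Real.sqrt (ScV n M R G W + e₁ + eG) + δ) ^ 2 := by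
  have hn : (0 : ℝ) < n := by exact_mod_cast Nat.pos_of_ne_zero (NeZero.ne n)
  have ha : 0 ≤ ScV n M R (fun _ => 0) W + e₁ := by
    have : 0 ≤ ScV n M R (fun _ => 0) W := by have := curlSq_nonneg (fine n M) R W; unfold ScV; positivity
    linarith
  have hb : 0 ≤ ((n : ℝ) ^ d)⁻¹ * ((n : ℝ) ^ 2 * G W) + eG := by have := hG0 W; positivity
  rw [SfV_eq_zero_add]
  calc SfV n L M R' (fun _ => 0) V + (((n : ℝ) * L) ^ d)⁻¹ * (((n : ℝ) * L) ^ 2 * G' V)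
      ≤ (Real.sqrt (ScV n M R (fun _ => 0) W + e₁) + δ) ^ 2 + (((n : ℝ) ^ d)⁻¹ * ((n : ℝ) ^ 2 * G W) + eG) := add_le_add hC hG
    _ ≤ (Real.sqrt (ScV n M R (fun _ => 0) W + e₁ + (((n : ℝ) ^ d)⁻¹ * ((n : ℝ) ^ 2 * G W) + eG)) + δ) ^ 2 := sq_sqrt_add_add_le ha hb hδ
    _ = (Real.sqrt (ScV n M R G W + e₁ + eG) + δ) ^ 2 := by rw [ScV_eq_zero_add n M R G W]; ring_nf

omit [InnerProductSpace ℂ E] [CompleteSpace E] [FiniteDimensional ℂ E] in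
/-- **THE `hONEm` SOCKET FROM (C)₀ ∧ (G′)** — the (ONE-min) binder of `VariationalAssemblySliceMin.vector_pair_bracket_sqrt_min_line` ∕ leaf-10-g3's
`VariationalVectorEndMonotone.upper_bracket_of_oneMin` EXACTLY, with `ρ := ρ₁ + ρ_G` and `ε₁ := max ε₁ ε_G`: for a competitor map `J` into the composite
fibre (`hQJ`; for `interpV` with the frame-adapted carriers this is `QvL_interpV` composed with ANY `Qk`) satisfying (C)₀ with `(ε₁, ρ₁, δ′)` and (G′) with
`(ε_G, ρ_G)` at every coarse field, the upper competitor exists at every coarse field (a fortiori at the minimiser; the minimality hypothesis is unused).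
V-REG for `ρ₁ + ρ_G` is the sum of the two V-REG statements. [folklore] -/
theorem hONEm_of_curl_oneG [NormedSpace ℂ E] {R : Tor (fine n M) → Fin d → (E →L[ℂ] E)} {R' : Tor (fine L (fine n M)) → Fin d → (E →L[ℂ] E)}
    {G : (Tor (fine n M) → Fin d → E) → ℝ} {G' : (Tor (fine L (fine n M)) → Fin d → E) → ℝ} (hG0 : ∀ W, 0 ≤ G W)
    {Z : Type*} {Qk : (Tor (fine n M) → Fin d → E) → Z} {Q₁ : (Tor (fine L (fine n M)) → Fin d → E) → (Tor (fine n M) → Fin d → E)}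
    {J : (Tor (fine n M) → Fin d → E) → (Tor (fine L (fine n M)) → Fin d → E)} (hQJ : ∀ W, Qk (Q₁ (J W)) = Qk W)
    {ρ₁ ρG : (Tor (fine n M) → Fin d → E) → ℝ} (hρ₁ : ∀ W, 0 ≤ ρ₁ W) (hρG : ∀ W, 0 ≤ ρG W) {ε₁ εG δ' : ℝ} (hε₁ : 0 ≤ ε₁) (hεG : 0 ≤ εG)
    (hδ' : 0 ≤ δ')
    (hC : ∀ W, SfV n L M R' (fun _ => 0) (J W) ≤ (Real.sqrt (ScV n M R (fun _ => 0) W + ε₁ * ρ₁ W) + δ' * Real.sqrt (qWV n M W)) ^ 2)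
    (hG : ∀ W, (((n : ℝ) * L) ^ d)⁻¹ * (((n : ℝ) * L) ^ 2 * G' (J W)) ≤ ((n : ℝ) ^ d)⁻¹ * ((n : ℝ) ^ 2 * G W) + εG * ρG W) :
    ∀ (φ : Z) (W₀ : Tor (fine n M) → Fin d → E), Qk W₀ = φ → (∀ W, Qk W = φ → ScV n M R G W₀ ≤ ScV n M R G W) →
      ∃ g, Qk (Q₁ g) = φ ∧ SfV n L M R' G' g
        ≤ (Real.sqrt (ScV n M R G W₀ + max ε₁ εG * (ρ₁ W₀ + ρG W₀)) + δ' * Real.sqrt (qWV n M W₀)) ^ 2 := by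
  intro φ W₀ hW₀ _
  refine ⟨J W₀, by rw [hQJ, hW₀], ?_⟩
  have h := SfV_le_of_curl_oneG n L M hG0 (mul_nonneg hε₁ (hρ₁ W₀)) (mul_nonneg hεG (hρG W₀)) (mul_nonneg hδ' (Real.sqrt_nonneg _))
    (hC W₀) (hG W₀)
  refine h.trans (pow_le_pow_left₀ (by positivity) (add_le_add (Real.sqrt_le_sqrt ?_) le_rfl) 2)
  have h1 : ε₁ * ρ₁ W₀ ≤ max ε₁ εG * ρ₁ W₀ := mul_le_mul_of_nonneg_right (le_max_left _ _) (hρ₁ W₀)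
  have h2 : εG * ρG W₀ ≤ max ε₁ εG * ρG W₀ := mul_le_mul_of_nonneg_right (le_max_right _ _) (hρG W₀)
  nlinarith

omit [InnerProductSpace ℂ E] [CompleteSpace E] [FiniteDimensional ℂ E] in
/-- the fine form in one-step coordinates IS the level-`L` form on the torus `fine n M` up to the factor `n^{2−d}`:
`SfV n L M R′ G′ V = (n^d)⁻¹·n²·ScV L (fine n M) R′ G′ V`. [folklore] -/
theorem SfV_eq_mul_ScV [NormedSpace ℂ E] (R' : Tor (fine L (fine n M)) → Fin d → (E →L[ℂ] E)) (G' : (Tor (fine L (fine n M)) → Fin d → E) → ℝ)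
    (V : Tor (fine L (fine n M)) → Fin d → E) : SfV n L M R' G' V = ((n : ℝ) ^ d)⁻¹ * (n : ℝ) ^ 2 * ScV L (fine n M) R' G' V := by
  have hn : (0 : ℝ) < n := by exact_mod_cast Nat.pos_of_ne_zero (NeZero.ne n)
  have hL : (0 : ℝ) < L := by exact_mod_cast Nat.pos_of_ne_zero (NeZero.ne L)
  unfold SfV ScV
  rw [mul_pow, mul_pow]
  field_simp

omit [InnerProductSpace ℂ E] [CompleteSpace E] [FiniteDimensional ℂ E] in
/-- **`√SfV` IS SUBADDITIVE** when `√G′` is (leaf-01-g7's `sqrt_ScV_add_le` at level `L` on the torus `fine n M`, rescaled). [folklore] -/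
theorem sqrt_SfV_add_le [NormedSpace ℂ E] (R' : Tor (fine L (fine n M)) → Fin d → (E →L[ℂ] E)) {G' : (Tor (fine L (fine n M)) → Fin d → E) → ℝ}
    (hG0' : ∀ V, 0 ≤ G' V) (hGadd' : ∀ A B, Real.sqrt (G' (A + B)) ≤ Real.sqrt (G' A) + Real.sqrt (G' B)) (A B : Tor (fine L (fine n M)) → Fin d → E) :
    Real.sqrt (SfV n L M R' G' (A + B)) ≤ Real.sqrt (SfV n L M R' G' A) + Real.sqrt (SfV n L M R' G' B) := by
  have hβ : 0 ≤ ((n : ℝ) ^ d)⁻¹ * (n : ℝ) ^ 2 := by positivity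
  rw [SfV_eq_mul_ScV, SfV_eq_mul_ScV, SfV_eq_mul_ScV, Real.sqrt_mul hβ, Real.sqrt_mul hβ, Real.sqrt_mul hβ, ← mul_add]
  exact mul_le_mul_of_nonneg_left (sqrt_ScV_add_le L (fine n M) R' hG0' hGadd' A B) (Real.sqrt_nonneg _)

omit [InnerProductSpace ℂ E] [CompleteSpace E] [FiniteDimensional ℂ E] in
/-- **THE `hONEm` SOCKET FROM (C)₀ ∧ (G′) FOR A COMPETITOR MAP THAT MISSES THE COMPOSITE FIBRE BY A SMALL UNIT DATUM** — the version the numerics of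
this item single out (memo `t4/T4-EST-NE2-P2-VONEG.md`: (G′) FAILS for V-ONE-1F's tilted `interpV`, whose composite constraint is exact, and HOLDS for the
componentwise centred interpolant, whose composite constraint is missed by `nsqV(Q_k W − Q_{k+1}(J W)) ≤ β·qWV W`, `β = O(n⁻¹)`): the defect datum is
re-absorbed by the FINE V-UB leaf (`hUBf`, landed) at cost `√(Λβ)·√(qWV W₀)` through the subadditivity of `√SfV`.  Conclusion = the (ONE-min) binder with
`ρ := ρ₁ + ρ_G`, `ε₁ := max ε₁ ε_G`, `δ′ := δ′ + √(Λβ)`. [folklore] -/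
theorem hONEm_of_curl_oneG_repair [NormedSpace ℂ E] {R : Tor (fine n M) → Fin d → (E →L[ℂ] E)} {R' : Tor (fine L (fine n M)) → Fin d → (E →L[ℂ] E)}
    {G : (Tor (fine n M) → Fin d → E) → ℝ} {G' : (Tor (fine L (fine n M)) → Fin d → E) → ℝ} (hG0 : ∀ W, 0 ≤ G W) (hG0' : ∀ V, 0 ≤ G' V)
    (hGadd' : ∀ A B, Real.sqrt (G' (A + B)) ≤ Real.sqrt (G' A) + Real.sqrt (G' B))
    {Qk : (Tor (fine n M) → Fin d → E) → (Tor M → Fin d → E)} {Q₁ : (Tor (fine L (fine n M)) → Fin d → E) → (Tor (fine n M) → Fin d → E)}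
    (hQadd : ∀ A B, Qk (Q₁ (A + B)) = Qk (Q₁ A) + Qk (Q₁ B))
    {J : (Tor (fine n M) → Fin d → E) → (Tor (fine L (fine n M)) → Fin d → E)} {β : ℝ} (hβ : 0 ≤ β)
    (hJdef : ∀ W, nsqV M (Qk W - Qk (Q₁ (J W))) ≤ β * qWV n M W)
    {Λ : ℝ} (hΛ : 0 ≤ Λ) (hUBf : ∀ φ : Tor M → Fin d → E, ∃ W', Qk (Q₁ W') = φ ∧ SfV n L M R' G' W' ≤ Λ * nsqV M φ)
    {ρ₁ ρG : (Tor (fine n M) → Fin d → E) → ℝ} (hρ₁ : ∀ W, 0 ≤ ρ₁ W) (hρG : ∀ W, 0 ≤ ρG W) {ε₁ εG δ' : ℝ} (hε₁ : 0 ≤ ε₁) (hεG : 0 ≤ εG)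
    (hδ' : 0 ≤ δ')
    (hC : ∀ W, SfV n L M R' (fun _ => 0) (J W) ≤ (Real.sqrt (ScV n M R (fun _ => 0) W + ε₁ * ρ₁ W) + δ' * Real.sqrt (qWV n M W)) ^ 2)
    (hG : ∀ W, (((n : ℝ) * L) ^ d)⁻¹ * (((n : ℝ) * L) ^ 2 * G' (J W)) ≤ ((n : ℝ) ^ d)⁻¹ * ((n : ℝ) ^ 2 * G W) + εG * ρG W) :
    ∀ (φ : Tor M → Fin d → E) (W₀ : Tor (fine n M) → Fin d → E), Qk W₀ = φ → (∀ W, Qk W = φ → ScV n M R G W₀ ≤ ScV n M R G W) →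
      ∃ g, Qk (Q₁ g) = φ ∧ SfV n L M R' G' g
        ≤ (Real.sqrt (ScV n M R G W₀ + max ε₁ εG * (ρ₁ W₀ + ρG W₀)) + (δ' + Real.sqrt (Λ * β)) * Real.sqrt (qWV n M W₀)) ^ 2 := by
  intro φ W₀ hW₀ hmin
  -- the exact-fibre part of the bound for `J W₀` (§3's `hONEm_of_curl_oneG` with `Qk := id`-bookkeeping redone inline)
  have hJ : SfV n L M R' G' (J W₀) ≤ (Real.sqrt (ScV n M R G W₀ + max ε₁ εG * (ρ₁ W₀ + ρG W₀)) + δ' * Real.sqrt (qWV n M W₀)) ^ 2 := by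
    have h := SfV_le_of_curl_oneG n L M hG0 (mul_nonneg hε₁ (hρ₁ W₀)) (mul_nonneg hεG (hρG W₀)) (mul_nonneg hδ' (Real.sqrt_nonneg _))
      (hC W₀) (hG W₀)
    refine h.trans (pow_le_pow_left₀ (by positivity) (add_le_add (Real.sqrt_le_sqrt ?_) le_rfl) 2)
    have h1 : ε₁ * ρ₁ W₀ ≤ max ε₁ εG * ρ₁ W₀ := mul_le_mul_of_nonneg_right (le_max_left _ _) (hρ₁ W₀)
    have h2 : εG * ρG W₀ ≤ max ε₁ εG * ρG W₀ := mul_le_mul_of_nonneg_right (le_max_right _ _) (hρG W₀)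
    nlinarith
  -- the repair of the composite-fibre defect by the fine V-UB leaf
  obtain ⟨W', hQW', hSW'⟩ := hUBf (φ - Qk (Q₁ (J W₀)))
  refine ⟨J W₀ + W', by rw [hQadd, hQW', add_sub_cancel], ?_⟩
  have hdef : nsqV M (φ - Qk (Q₁ (J W₀))) ≤ β * qWV n M W₀ := by rw [← hW₀]; exact hJdef W₀
  have hrep : Real.sqrt (SfV n L M R' G' W') ≤ Real.sqrt (Λ * β) * Real.sqrt (qWV n M W₀) := by
    rw [← Real.sqrt_mul (mul_nonneg hΛ hβ)]
    refine Real.sqrt_le_sqrt (hSW'.trans ?_)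
    rw [mul_assoc]
    exact mul_le_mul_of_nonneg_left hdef hΛ
  have hsum := sqrt_SfV_add_le n L M R' hG0' hGadd' (J W₀) W'
  have hJ' : Real.sqrt (SfV n L M R' G' (J W₀)) ≤ Real.sqrt (ScV n M R G W₀ + max ε₁ εG * (ρ₁ W₀ + ρG W₀)) + δ' * Real.sqrt (qWV n M W₀) := by
    rw [← Real.sqrt_sq (by positivity : (0 : ℝ) ≤ Real.sqrt (ScV n M R G W₀ + max ε₁ εG * (ρ₁ W₀ + ρG W₀)) + δ' * Real.sqrt (qWV n M W₀))]
    exact Real.sqrt_le_sqrt hJ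
  have h0 : 0 ≤ SfV n L M R' G' (J W₀ + W') := SfV_nonneg n L M R' hG0' _
  calc SfV n L M R' G' (J W₀ + W') = Real.sqrt (SfV n L M R' G' (J W₀ + W')) ^ 2 := (Real.sq_sqrt h0).symm
    _ ≤ (Real.sqrt (SfV n L M R' G' (J W₀)) + Real.sqrt (SfV n L M R' G' W')) ^ 2 := pow_le_pow_left₀ (Real.sqrt_nonneg _) hsum 2
    _ ≤ _ := by
        refine pow_le_pow_left₀ (by positivity) ?_ 2
        calc Real.sqrt (SfV n L M R' G' (J W₀)) + Real.sqrt (SfV n L M R' G' W')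
            ≤ (Real.sqrt (ScV n M R G W₀ + max ε₁ εG * (ρ₁ W₀ + ρG W₀)) + δ' * Real.sqrt (qWV n M W₀))
              + Real.sqrt (Λ * β) * Real.sqrt (qWV n M W₀) := add_le_add hJ' hrep
          _ = _ := by ring

end OneMin

end Summit.QuantumFields.BalabanUV.T4Continuum.VariationalVectorGaugeSliceDist

end
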